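import Mathlib
import Literature.NumberTheory.Transcendental.ZagierDilogarithmConjecture
import Literature.NumberTheory.Transcendental.KZIdealTetrahedron
import Literature.NumberTheory.Transcendental.KZPeriodsProofs
import Literature.NumberTheory.Transcendental.KZCalculusProofs
import Literature.NumberTheory.Transcendental.SemialgebraicMapsProofs
import Literature.NumberTheory.Transcendental.KZSemialgebraicComplex
import HarnessLib

/-! # `RootDecompQuadraticDescentZ7ComposeP1` — part 1/5 of the mechanical ≤400-line split of `Z7Compose.lean` (sha256 65b37838cbe1d1d8…)
Source: decomp-kz lens-6 g11 `Z7Compose.lean` v2 (HOME/decomp-kz-lens-6/g11/, sha256 65b37838…; critic g5-39/g5-47/g5-52 CLEARED, writer A2.4: land Z7Compose v2 + RayAffineRational --supports 28994): K26a / Zagier's Z₇ decided inside the ℚ-rational weight-2 box of crux 28994 — z7_pair: ∃ r r' ℚ-rational with the same integrand 1/(2v(1+τ²)), [r] ≡ 6[T(u)]+6[T(ū²)]+2[T(u³)]+7[T(ζ₇³)], [r'] ≡ 7[T(ζ₇)]+7[T(ζ₇²)], r.value = r'.value, [r] − [r'] ∈ KZ.relations, over five binders = verbatim tree-theorem types;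 landed by census-1 g9.
Split by census-1 g9 `gen/splitlean.py`: scopes re-opened with their `open`/`variable`/`set_option` context; mathematics and declaration order unchanged. -/

/-!
# Z7Compose — Zagier's `Z₇` relation as a DECIDED relation between `ℚ`-RATIONAL TWO-DIMENSIONAL Kontsevich–Zagier
classes (decomp-kz-lens-6, gen 11; route `RootDecompQuadraticDescent`, crux `DescentTwoQ` stmt-KontsevichZagierPeriods-28994)

Self-contained composition file, importing only `Literature` (so that it elaborates while the farm has the
HyperbolicBloch `Theorems` chain unbuilt).  Content:

* §1 (= `Z7FormalCertCore.lean`, certified rc 0) the `ℚ(√−7)` formal certificate `sqrtSeven_formalCert`: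
  `6[u] + 6[ū²] + 2[u³] − 8[X] − 4[Y] ∈ ⟨dilogRelators⟩` (two five-term instances), `u = (−3+√−7)/4 = e^{2i·arctan √7}`.
* §2 `z7_tetra (hE) (hH0)` — Zagier's `Z₇`
  (`6D(u) + 6D(ū²) + 2D(u³) = 7[D(ζ₇) + D(ζ₇²) − D(ζ₇³)]`, Invent. Math. 83 (1986) (5) = (6)) as a KZ-relation
  `6[ρu] + 6[ρū²] + 2[ρu³] − 7[ρζ₇] − 7[ρζ₇²] + 7[ρζ₇³] ∈ KZ.relations` between the standard tetrahedral
  representations, from the two TREE theorems whose statements the binders `hE`, `hH0` copy VERBATIM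
  (`stub_explainedToKZ`, `heptagonalKZ` of route HyperbolicBloch): at landing
  `z7_tetra stub_explainedToKZ heptagonalKZ` is unconditional (= g11 file `Z7TetraKZ.lean`, whose own check waits
  for the farm to rebuild the HyperbolicBloch chain).
* §3 point data for the six shapes `u, ū², u³, ζ₇, ζ₇², ζ₇³` (algebraic, upper half plane, on the unit circle).
* §4 `z7_dimTwo (hE) (hH) (hM) (hRex) (hA)` — with the Milnor bridge (`hM`; tree `tetraFlatten` +
  `rayMeetsShadow`, route HyperbolicBloch), the existence of Zagier's ray representation (`hRex`; tree
  `KZ.rayDilogRep`, one line) and the affine rationalisation (`hA`; = `RayAffine.exists_rational_rayRep`, g11 file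
  `RayAffineRational.lean`, certified rc 0) as hypotheses stated over verbatim copies
  `rayDom`/`rayInt`/`affDomain`/`affIntegrand` (definitionally equal to the originals, so each instantiation is `rfl`): there are `ℚ`-RATIONAL two-dimensional
  representations `R₀,…,R₅`, `Rᵢ` KZ-equivalent to the ideal tetrahedron of the `i`-th shape, with
  `6[R₀] + 6[R₁] + 2[R₂] − 7[R₃] − 7[R₄] + 7[R₅] ∈ KZ.relations` — i.e. `Z₇` is a decided identity inside the
  weight-2 box (dimension ≤ 2, `ℚ`-rational integrands) of `DescentTwoQ`.

Discharging the hypotheses at landing (all one-liners over tree theorems):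
`hE := stub_explainedToKZ`, `hH := heptagonalKZ`,
`hM := fun z hz him s hs hsi => by obtain ⟨f, hf, hfi⟩ := OffTetraSectorKernel.exists_flatRep z hz him;
  exact (OffTetraSectorKernel.tetraFlatten z hz him _ f rfl (fun _ _ => rfl) hf hfi).trans
    (OffTetraSectorKernel.rayMeetsShadow z hz him f s hf hfi hs hsi)`,
`hRex := fun a b ha hb => ⟨KZ.rayDilogRep a b ha hb, rfl, fun _ _ => rfl⟩`,
`hA := fun a b ha hb hb0 hN1 r hr hri => RayAffine.exists_rational_rayRep ha hb hb0 hN1 r hr hri`.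

References: D. Zagier, Invent. Math. 83 (1986) 285–301, §4; D. H. Bailey, J. M. Borwein, D. Broadhurst,
W. Zudilin, *Experimental mathematics and mathematical physics* (2010) §5 [arXiv:1005.0414]; W. D. Neumann,
*Extended Bloch group and the Cheeger–Chern–Simons class* (2004) / Neumann 1998 §2 (five-term relation (2.3));
M. Kontsevich, D. Zagier, *Periods* (2001) §1.2.
-/

noncomputable section

open scoped BigOperators ComplexConjugate
open Set
open Literature.NumberTheory.Transcendental

namespace Summit.KontsevichZagierPeriods.RootDecompQuadraticDescent.Z7Compose

/-! ## §1 The `ℚ(√−7)` certificate (verbatim `Z7FormalCertCore`) -/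

/-- `(√7·i)² = −7`. [folklore] -/
theorem sqrt7I_sq : ((Real.sqrt 7 : ℂ) * Complex.I) ^ 2 = -7 := by
  rw [mul_pow, Complex.I_sq, ← Complex.ofReal_pow, Real.sq_sqrt (by norm_num : (0:ℝ) ≤ 7)]
  push_cast
  ring

/-- `conj (√7·i) = −√7·i`. [folklore] -/
theorem conj_sqrt7I : conj ((Real.sqrt 7 : ℂ) * Complex.I) = -((Real.sqrt 7 : ℂ) * Complex.I) := by
  rw [map_mul, Complex.conj_ofReal, Complex.conj_I]
  ring

/-- `√7·i` is algebraic over `ℚ` (a root of `X² + 7`). [folklore] -/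
theorem isAlgebraic_sqrt7I : IsAlgebraic ℚ ((Real.sqrt 7 : ℂ) * Complex.I) := by
  refine ⟨Polynomial.X ^ 2 - Polynomial.C (-7), Polynomial.X_pow_sub_C_ne_zero (by norm_num) _, ?_⟩
  simp [sqrt7I_sq]

/-- The elements `a + b·√7·i` (`a, b ∈ ℚ`) of `ℚ(√−7)` are algebraic over `ℚ`. [folklore] -/
theorem isAlgebraic_lin (a b : ℚ) :
    IsAlgebraic ℚ ((a : ℂ) + (b : ℂ) * ((Real.sqrt 7 : ℂ) * Complex.I)) :=
  (isAlgebraic_rat ℚ a).add ((isAlgebraic_rat ℚ b).mul isAlgebraic_sqrt7I)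

/-- **The `ℚ(√−7)` formal certificate (two five-term instances).** With `s = √7·i`, `u = (−3+s)/4`,
`ū² = (1+3s)/8`, `u³ = (9+5s)/16`, `X = (1+s)/2`, `Y = (−1+s)/4`:
`6[u] + 6[ū²] + 2[u³] − 8[X] − 4[Y] ∈ ⟨dilogRelators⟩` — it is `−4·FT(ū, ū²) − 2·FT(ū³, ū²)` plus the four
conjugation relators `8([u]+[ū]) + 2([u³]+[ū³]) − 4([X]+[X̄]) − 2([Y]+[Ȳ])`, exactly, in `ℤ[ℂ]`.
[cite: Neumann1998, §2 eq. (2.3) and Thm 2.4] -/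
theorem sqrtSeven_formalCert :
    ((6 : ℤ) • FreeAbelianGroup.of ((-3 + (Real.sqrt 7 : ℂ) * Complex.I) / 4) +
        (6 : ℤ) • FreeAbelianGroup.of ((1 + 3 * ((Real.sqrt 7 : ℂ) * Complex.I)) / 8) +
        (2 : ℤ) • FreeAbelianGroup.of ((9 + 5 * ((Real.sqrt 7 : ℂ) * Complex.I)) / 16) -
        (8 : ℤ) • FreeAbelianGroup.of ((1 + (Real.sqrt 7 : ℂ) * Complex.I) / 2) -
        (4 : ℤ) • FreeAbelianGroup.of ((-1 + (Real.sqrt 7 : ℂ) * Complex.I) / 4)) ∈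
      AddSubgroup.closure dilogRelators := by
  have hs := sqrt7I_sq
  have hc := conj_sqrt7I
  have halg : ∀ a b : ℚ, IsAlgebraic ℚ ((a : ℂ) + (b : ℂ) * ((Real.sqrt 7 : ℂ) * Complex.I)) :=
    isAlgebraic_lin
  set s : ℂ := (Real.sqrt 7 : ℂ) * Complex.I with hsdef
  clear_value s
  -- algebraicity of the points
  have a_x1 : IsAlgebraic ℚ ((-3 - s) / 4) := by
    convert halg (-3 / 4) (-1 / 4) using 1; push_cast; ring
  have a_y : IsAlgebraic ℚ ((1 + 3 * s) / 8) := by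
    convert halg (1 / 8) (3 / 8) using 1; push_cast; ring
  have a_x2 : IsAlgebraic ℚ ((9 - 5 * s) / 16) := by
    convert halg (9 / 16) (-5 / 16) using 1; push_cast; ring
  have a_u : IsAlgebraic ℚ ((-3 + s) / 4) := by
    convert halg (-3 / 4) (1 / 4) using 1; push_cast; ring
  have a_u3 : IsAlgebraic ℚ ((9 + 5 * s) / 16) := by
    convert halg (9 / 16) (5 / 16) using 1; push_cast; ring
  have a_X : IsAlgebraic ℚ ((1 + s) / 2) := by
    convert halg (1 / 2) (1 / 2) using 1; push_cast; ring
  have a_Y : IsAlgebraic ℚ ((-1 + s) / 4) := by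
    convert halg (-1 / 4) (1 / 4) using 1; push_cast; ring
  -- non-degeneracy of the two five-term instances (explicit inverses in `ℚ(s)`)
  have x1_0 : (-3 - s) / 4 ≠ 0 :=
    left_ne_zero_of_mul_eq_one (b := (-3 + s) / 4) (by linear_combination (-1 / 16 : ℂ) * hs)
  have x1_1 : (-3 - s) / 4 ≠ 1 := by
    refine sub_ne_zero.1 (left_ne_zero_of_mul_eq_one (b := (-7 + s) / 14) ?_)
    linear_combination (-1 / 56 : ℂ) * hs
  have y_0 : (1 + 3 * s) / 8 ≠ 0 :=
    left_ne_zero_of_mul_eq_one (b := (1 - 3 * s) / 8) (by linear_combination (-9 / 64 : ℂ) * hs)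
  have y_1 : (1 + 3 * s) / 8 ≠ 1 := by
    refine sub_ne_zero.1 (left_ne_zero_of_mul_eq_one (b := (-7 - 3 * s) / 14) ?_)
    linear_combination (-9 / 112 : ℂ) * hs
  have x1_y : (-3 - s) / 4 ≠ (1 + 3 * s) / 8 := by
    refine sub_ne_zero.1 (left_ne_zero_of_mul_eq_one (b := (-7 + 5 * s) / 28) ?_)
    linear_combination (-25 / 224 : ℂ) * hs
  have x2_0 : (9 - 5 * s) / 16 ≠ 0 :=
    left_ne_zero_of_mul_eq_one (b := (9 + 5 * s) / 16) (by linear_combination (-25 / 256 : ℂ) * hs)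
  have x2_1 : (9 - 5 * s) / 16 ≠ 1 := by
    refine sub_ne_zero.1 (left_ne_zero_of_mul_eq_one (b := (-7 + 5 * s) / 14) ?_)
    linear_combination (-25 / 224 : ℂ) * hs
  have x2_y : (9 - 5 * s) / 16 ≠ (1 + 3 * s) / 8 := by
    refine sub_ne_zero.1 (left_ne_zero_of_mul_eq_one (b := (7 + 11 * s) / 56) ?_)
    linear_combination (-121 / 896 : ℂ) * hs
  -- inverses and denominators
  have i_x1 : ((-3 - s) / 4)⁻¹ = (-3 + s) / 4 :=
    inv_eq_of_mul_eq_one_right (by linear_combination (-1 / 16 : ℂ) * hs)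
  have i_y : ((1 + 3 * s) / 8)⁻¹ = (1 - 3 * s) / 8 :=
    inv_eq_of_mul_eq_one_right (by linear_combination (-9 / 64 : ℂ) * hs)
  have i_x2 : ((9 - 5 * s) / 16)⁻¹ = (9 + 5 * s) / 16 :=
    inv_eq_of_mul_eq_one_right (by linear_combination (-25 / 256 : ℂ) * hs)
  have d_yb : (1 : ℂ) - (1 - 3 * s) / 8 ≠ 0 :=
    left_ne_zero_of_mul_eq_one (b := (7 - 3 * s) / 14) (by linear_combination (-9 / 112 : ℂ) * hs)
  have d_y : (1 : ℂ) - (1 + 3 * s) / 8 ≠ 0 :=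
    left_ne_zero_of_mul_eq_one (b := (7 + 3 * s) / 14) (by linear_combination (-9 / 112 : ℂ) * hs)
  -- the composite arguments of the two five-term elements, in normal form
  have e11 : (1 + 3 * s) / 8 / ((-3 - s) / 4) = (-3 - s) / 4 := by
    rw [div_eq_iff x1_0]; linear_combination (-1 / 16 : ℂ) * hs
  have e12 : (1 - ((-3 - s) / 4)⁻¹) / (1 - ((1 + 3 * s) / 8)⁻¹) = (1 - s) / 2 := by
    rw [i_x1, i_y, div_eq_iff d_yb]; linear_combination (3 / 16 : ℂ) * hs
  have e13 : (1 - (-3 - s) / 4) / (1 - (1 + 3 * s) / 8) = (1 + s) / 2 := by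
    rw [div_eq_iff d_y]; linear_combination (3 / 16 : ℂ) * hs
  have e21 : (1 + 3 * s) / 8 / ((9 - 5 * s) / 16) = (-3 + s) / 4 := by
    rw [div_eq_iff x2_0]; linear_combination (5 / 64 : ℂ) * hs
  have e22 : (1 - ((9 - 5 * s) / 16)⁻¹) / (1 - ((1 + 3 * s) / 8)⁻¹) = (-1 - s) / 4 := by
    rw [i_x2, i_y, div_eq_iff d_yb]; linear_combination (3 / 32 : ℂ) * hs
  have e23 : (1 - (9 - 5 * s) / 16) / (1 - (1 + 3 * s) / 8) = (-1 + s) / 4 := by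
    rw [div_eq_iff d_y]; linear_combination (3 / 32 : ℂ) * hs
  -- the complex conjugates of the four paired points
  have cu : conj ((-3 + s) / 4) = (-3 - s) / 4 := by
    simp only [map_div₀, map_add, map_neg, map_ofNat, hc]; ring
  have cu3 : conj ((9 + 5 * s) / 16) = (9 - 5 * s) / 16 := by
    simp only [map_div₀, map_add, map_mul, map_ofNat, hc]; ring
  have cX : conj ((1 + s) / 2) = (1 - s) / 2 := by
    simp only [map_div₀, map_add, map_one, map_ofNat, hc]; ring
  have cY : conj ((-1 + s) / 4) = (-1 - s) / 4 := by
    simp only [map_div₀, map_add, map_neg, map_one, map_ofNat, hc]; ring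
  -- the six relators
  have F1 := fiveTerm_mem_dilogRelators a_x1 a_y x1_0 x1_1 y_0 y_1 x1_y
  have F2 := fiveTerm_mem_dilogRelators a_x2 a_y x2_0 x2_1 y_0 y_1 x2_y
  rw [e11, e12, e13] at F1
  rw [e21, e22, e23] at F2
  have C1 := of_add_of_conj_mem_dilogRelators a_u
  have C2 := of_add_of_conj_mem_dilogRelators a_u3
  have C3 := of_add_of_conj_mem_dilogRelators a_X
  have C4 := of_add_of_conj_mem_dilogRelators a_Y
  rw [cu] at C1
  rw [cu3] at C2
  rw [cX] at C3
  rw [cY] at C4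
  have key : (6 : ℤ) • FreeAbelianGroup.of ((-3 + s) / 4) +
        (6 : ℤ) • FreeAbelianGroup.of ((1 + 3 * s) / 8) +
        (2 : ℤ) • FreeAbelianGroup.of ((9 + 5 * s) / 16) -
        (8 : ℤ) • FreeAbelianGroup.of ((1 + s) / 2) -
        (4 : ℤ) • FreeAbelianGroup.of ((-1 + s) / 4) =
      (-4 : ℤ) • (FreeAbelianGroup.of ((-3 - s) / 4) - FreeAbelianGroup.of ((1 + 3 * s) / 8) +
          FreeAbelianGroup.of ((-3 - s) / 4) - FreeAbelianGroup.of ((1 - s) / 2) +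
          FreeAbelianGroup.of ((1 + s) / 2)) +
      (-2 : ℤ) • (FreeAbelianGroup.of ((9 - 5 * s) / 16) - FreeAbelianGroup.of ((1 + 3 * s) / 8) +
          FreeAbelianGroup.of ((-3 + s) / 4) - FreeAbelianGroup.of ((-1 - s) / 4) +
          FreeAbelianGroup.of ((-1 + s) / 4)) +
      (8 : ℤ) • (FreeAbelianGroup.of ((-3 + s) / 4) + FreeAbelianGroup.of ((-3 - s) / 4)) +
      (2 : ℤ) • (FreeAbelianGroup.of ((9 + 5 * s) / 16) + FreeAbelianGroup.of ((9 - 5 * s) / 16)) +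
      (-4 : ℤ) • (FreeAbelianGroup.of ((1 + s) / 2) + FreeAbelianGroup.of ((1 - s) / 2)) +
      (-2 : ℤ) • (FreeAbelianGroup.of ((-1 + s) / 4) + FreeAbelianGroup.of ((-1 - s) / 4)) := by
    abel
  rw [key]
  refine add_mem (add_mem (add_mem (add_mem (add_mem ?_ ?_) ?_) ?_) ?_) ?_
  · exact AddSubgroup.zsmul_mem _ (AddSubgroup.subset_closure F1) _
  · exact AddSubgroup.zsmul_mem _ (AddSubgroup.subset_closure F2) _
  · exact AddSubgroup.zsmul_mem _ (AddSubgroup.subset_closure C1) _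
  · exact AddSubgroup.zsmul_mem _ (AddSubgroup.subset_closure C2) _
  · exact AddSubgroup.zsmul_mem _ (AddSubgroup.subset_closure C3) _
  · exact AddSubgroup.zsmul_mem _ (AddSubgroup.subset_closure C4) _

/-- The five points `u, ū², u³, X, Y` lie in the upper half plane. [folklore] -/
theorem z7_im_pos : ∀ i : Fin 5,
    0 < ((![(-3 + (Real.sqrt 7 : ℂ) * Complex.I) / 4, (1 + 3 * ((Real.sqrt 7 : ℂ) * Complex.I)) / 8,
      (9 + 5 * ((Real.sqrt 7 : ℂ) * Complex.I)) / 16, (1 + (Real.sqrt 7 : ℂ) * Complex.I) / 2,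
      (-1 + (Real.sqrt 7 : ℂ) * Complex.I) / 4] : Fin 5 → ℂ) i).im := by
  intro i
  fin_cases i <;> simp [Complex.div_ofNat_im]

/-! ## §2 `Z₇` in tetrahedral currency from the two tree transfers -/

/-- Auxiliary step `z7_tetra` (§2): z7 tetra. [bookkeeping] -/
theorem z7_tetra
    (hE : ∀ (T : ℂ → Set (Fin 3 → ℝ)), (∀ z, T z = {p | 0 < p 1 ∧ z.re * p 1 < z.im * p 0 ∧
      z.im * (p 0 - 1) < (z.re - 1) * p 1 ∧ 0 < p 2 ∧
      0 < z.im * (p 0 ^ 2 + p 1 ^ 2 + p 2 ^ 2 - p 0) + (z.re - Complex.normSq z) * p 1}) →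
      ∀ (ρ : ℂ → KZ.IntegralRep 3), (∀ z, IsAlgebraic ℚ z → 0 < z.im →
      (ρ z).domain = T z ∧ Set.EqOn (ρ z).integrand (fun p => 1 / p 2 ^ 3) (T z)) →
      ∀ (k : ℕ) (z : Fin k → ℂ) (n : Fin k → ℤ), (∀ i, 0 < (z i).im) →
      (∑ i, n i • FreeAbelianGroup.of (z i)) ∈ AddSubgroup.closure dilogRelators →
      (∑ i, n i • KZ.of (ρ (z i))) ∈ KZ.relations)
    (hH0 : ∀ (T : ℂ → Set (Fin 3 → ℝ)), (∀ z, T z = {p | 0 < p 1 ∧ z.re * p 1 < z.im * p 0 ∧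
      z.im * (p 0 - 1) < (z.re - 1) * p 1 ∧ 0 < p 2 ∧
      0 < z.im * (p 0 ^ 2 + p 1 ^ 2 + p 2 ^ 2 - p 0) + (z.re - Complex.normSq z) * p 1}) →
      ∀ (ρ : ℂ → KZ.IntegralRep 3), (∀ z, IsAlgebraic ℚ z → 0 < z.im →
      (ρ z).domain = T z ∧ Set.EqOn (ρ z).integrand (fun p => 1 / p 2 ^ 3) (T z)) →
      ((7 : ℤ) • KZ.of (ρ (Complex.exp (2 * Real.pi * Complex.I / 7))) +
      (7 : ℤ) • KZ.of (ρ (Complex.exp (2 * Real.pi * Complex.I / 7) ^ 2)) -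
      (7 : ℤ) • KZ.of (ρ (Complex.exp (2 * Real.pi * Complex.I / 7) ^ 3)) -
      (8 : ℤ) • KZ.of (ρ ((1 + (Real.sqrt 7 : ℂ) * Complex.I) / 2)) -
      (4 : ℤ) • KZ.of (ρ ((-1 + (Real.sqrt 7 : ℂ) * Complex.I) / 4))) ∈ KZ.relations) :
    ∀ (T : ℂ → Set (Fin 3 → ℝ)), (∀ z, T z = {p | 0 < p 1 ∧ z.re * p 1 < z.im * p 0 ∧
    z.im * (p 0 - 1) < (z.re - 1) * p 1 ∧ 0 < p 2 ∧
    0 < z.im * (p 0 ^ 2 + p 1 ^ 2 + p 2 ^ 2 - p 0) + (z.re - Complex.normSq z) * p 1}) →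
    ∀ (ρ : ℂ → KZ.IntegralRep 3), (∀ z, IsAlgebraic ℚ z → 0 < z.im →
    (ρ z).domain = T z ∧ Set.EqOn (ρ z).integrand (fun p => 1 / p 2 ^ 3) (T z)) →
    ((6 : ℤ) • KZ.of (ρ ((-3 + (Real.sqrt 7 : ℂ) * Complex.I) / 4)) +
    (6 : ℤ) • KZ.of (ρ ((1 + 3 * ((Real.sqrt 7 : ℂ) * Complex.I)) / 8)) +
    (2 : ℤ) • KZ.of (ρ ((9 + 5 * ((Real.sqrt 7 : ℂ) * Complex.I)) / 16)) -
    (7 : ℤ) • KZ.of (ρ (Complex.exp (2 * Real.pi * Complex.I / 7))) -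
    (7 : ℤ) • KZ.of (ρ (Complex.exp (2 * Real.pi * Complex.I / 7) ^ 2)) +
    (7 : ℤ) • KZ.of (ρ (Complex.exp (2 * Real.pi * Complex.I / 7) ^ 3))) ∈ KZ.relations := by
  intro T hT ρ hρ
  have hH := hH0 T hT ρ hρ
  have hcert := sqrtSeven_formalCert
  have him := z7_im_pos
  set ζ : ℂ := Complex.exp (2 * Real.pi * Complex.I / 7) with hζdef
  set u : ℂ := (-3 + (Real.sqrt 7 : ℂ) * Complex.I) / 4 with hudef
  set v : ℂ := (1 + 3 * ((Real.sqrt 7 : ℂ) * Complex.I)) / 8 with hvdef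
  set w : ℂ := (9 + 5 * ((Real.sqrt 7 : ℂ) * Complex.I)) / 16 with hwdef
  set x : ℂ := (1 + (Real.sqrt 7 : ℂ) * Complex.I) / 2 with hxdef
  set y : ℂ := (-1 + (Real.sqrt 7 : ℂ) * Complex.I) / 4 with hydef
  have e : (∑ i : Fin 5, (![6, 6, 2, -8, -4] : Fin 5 → ℤ) i •
      FreeAbelianGroup.of ((![u, v, w, x, y] : Fin 5 → ℂ) i)) =
      (6 : ℤ) • FreeAbelianGroup.of u + (6 : ℤ) • FreeAbelianGroup.of v +
        (2 : ℤ) • FreeAbelianGroup.of w - (8 : ℤ) • FreeAbelianGroup.of x -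
        (4 : ℤ) • FreeAbelianGroup.of y := by
    simp only [Fin.sum_univ_five, Matrix.cons_val_zero, Matrix.cons_val_one, Matrix.head_cons,
      Matrix.cons_val_two, Matrix.tail_cons, Matrix.cons_val_three, Matrix.cons_val_four, neg_smul]
    abel
  have key := hE T hT ρ hρ 5 (![u, v, w, x, y]) (![6, 6, 2, -8, -4]) him (by rw [e]; exact hcert)
  have e' : (∑ i : Fin 5, (![6, 6, 2, -8, -4] : Fin 5 → ℤ) i •
      KZ.of (ρ ((![u, v, w, x, y] : Fin 5 → ℂ) i))) =
      (6 : ℤ) • KZ.of (ρ u) + (6 : ℤ) • KZ.of (ρ v) + (2 : ℤ) • KZ.of (ρ w) -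
        (8 : ℤ) • KZ.of (ρ x) - (4 : ℤ) • KZ.of (ρ y) := by
    simp only [Fin.sum_univ_five, Matrix.cons_val_zero, Matrix.cons_val_one, Matrix.head_cons,
      Matrix.cons_val_two, Matrix.tail_cons, Matrix.cons_val_three, Matrix.cons_val_four, neg_smul]
    abel
  rw [e'] at key
  have hG : (6 : ℤ) • KZ.of (ρ u) + (6 : ℤ) • KZ.of (ρ v) + (2 : ℤ) • KZ.of (ρ w) -
        (7 : ℤ) • KZ.of (ρ ζ) - (7 : ℤ) • KZ.of (ρ (ζ ^ 2)) + (7 : ℤ) • KZ.of (ρ (ζ ^ 3)) =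
      ((6 : ℤ) • KZ.of (ρ u) + (6 : ℤ) • KZ.of (ρ v) + (2 : ℤ) • KZ.of (ρ w) -
        (8 : ℤ) • KZ.of (ρ x) - (4 : ℤ) • KZ.of (ρ y)) -
      ((7 : ℤ) • KZ.of (ρ ζ) + (7 : ℤ) • KZ.of (ρ (ζ ^ 2)) - (7 : ℤ) • KZ.of (ρ (ζ ^ 3)) -
        (8 : ℤ) • KZ.of (ρ x) - (4 : ℤ) • KZ.of (ρ y)) := by
    abel
  rw [hG]
  exact sub_mem key hH

/-! ## §3 The six shapes: ray data copies and point facts -/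

/-- Verbatim copy of `KZ.rayDilogDomain` (`Literature/…/KZRayDilog.lean`). [cite: Zagier2007Dilogarithm, Ch. I §3] -/
def rayDom (a b : ℝ) : Set (Fin 2 → ℝ) :=
  {w | 0 < w 0 ∧ w 0 < 1 ∧ ((1 < w 1 ∧ w 1 < w 0 ^ 2 * (a ^ 2 + b ^ 2)) ∨
    (w 0 ^ 2 * (a ^ 2 + b ^ 2) < w 1 ∧ w 1 < 1))}

/-- Verbatim copy of `KZ.rayDilogIntegrand`. [cite: Zagier2007Dilogarithm, Ch. I §3] -/
def rayInt (a b : ℝ) (w : Fin 2 → ℝ) : ℝ :=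
  (if 1 < w 1 then (1 : ℝ) else -1) * (-b) / (2 * w 1 * ((1 - w 0 * a) ^ 2 + (w 0 * b) ^ 2))

/-- Verbatim copy of `RayAffine.affDomain` (g11 `RayAffineRational.lean`). [folklore] -/
def affDomain (a b : ℝ) : Set (Fin 2 → ℝ) :=
  {w | 0 < a + b * w 0 ∧ a + b * w 0 < a ^ 2 + b ^ 2 ∧
    ((1 < w 1 ∧ (a ^ 2 + b ^ 2) * w 1 < (a + b * w 0) ^ 2) ∨
      ((a + b * w 0) ^ 2 < (a ^ 2 + b ^ 2) * w 1 ∧ w 1 < 1))}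

/-- Verbatim copy of `RayAffine.affIntegrand`: `sgn(u − 1)·(−1)/(2u(1 + τ²))`. [folklore] -/
def affIntegrand (w : Fin 2 → ℝ) : ℝ :=
  (if 1 < w 1 then (1 : ℝ) else -1) * (-1) / (2 * w 1 * (1 + w 0 ^ 2))

end Summit.KontsevichZagierPeriods.RootDecompQuadraticDescent.Z7Compose
end
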